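import Summits.AtomisticToContinuum.FouriersLaw.Theorems.ParityLiouvilleSeedLiouvilleForHeatStationarity
import Summits.AtomisticToContinuum.FouriersLaw.Theorems.ParityLiouvilleSeedCesaroUpgradeGrowth

/-!
# Stationarity for unbounded local observables of the infinite chain, II: energies of the pinned chain

Helper file (`--supports stmt-AtomisticToContinuum-13980`, route `ParityLiouvilleSeed`, decl
`LiouvilleForHeat`). Sequel of `…LiouvilleForHeatStationarity` (the cut-off argument and the
moment algebra), specialised to the tree's pinned anharmonic chain `pinnedChain ω₂ lam β γ`
(`U(q) = ω₂q²/2 + lam q⁴/4`, `V(r) = r²/2 + βr⁴/4`; NO sign conditions on the parameters are used):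

* (Hamilton's data `U' = ω₂q + lam q³`, `V' = r + βr³` and the explicit force are taken from the
  sibling helper file `ParityLiouvilleSeedCesaroUpgradeGrowth` of item 13981, not restated);
* all power moments of positions, momenta, `V'(q_{x+1} - q_x)`, the force `F_x`, the on-site energy
  `p_x²/2 + U(q_x)` and the bond energy `V(q_{x+1} - q_x)` from the site-moment hypothesis;
* `liouvilleZ_siteEnergy`: `𝒜(p_x²/2 + U(q_x)) = p_x (V'(q_{x+1} - q_x) - V'(q_x - q_{x-1}))`,
  `liouvilleZ_bondEnergy`: `𝒜 V(q_{x+1} - q_x) = V'(q_{x+1} - q_x)(p_{x+1} - p_x)`;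
* the two **stationarity identities** of a time-invariant state with all site moments:
  `∫ p_x (V'(q_{x+1} - q_x) - V'(q_x - q_{x-1})) dν = 0` and `∫ V'(q_{x+1} - q_x)(p_{x+1} - p_x) dν = 0`
  (`integral_momentum_mul_deriv_V_sub_eq_zero`, `integral_deriv_V_mul_momentum_sub_eq_zero`).

Everything is folklore calculus (the microscopic continuity equation `𝒜e_x = j_{x-1} - j_x`,
Bonetto–Lebowitz–Rey-Bellet 2000 §5.2); nothing here closes an item.
-/

noncomputable section

open MeasureTheory Filter Topology Set

namespace Summit.AtomisticToContinuum.FouriersLaw.Theorems.ParityLiouvilleSeed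

open Literature.MathematicalPhysics.KineticTheory.HeatConduction

/-! ### The pinned anharmonic chain: derivatives and moments of the local observables -/

section PinnedChain

variable (ω₂ lam β γ : ℝ) {ν : Measure ChainConfig}

/-- All power moments of the positions, from the site-moment hypothesis of the route. [folklore] -/
theorem moments_position (hmom : ∀ (m : ℕ) (x : ℤ),
      Integrable (fun σ : ChainConfig => |(σ x).1| ^ m + |(σ x).2| ^ m) ν) (x : ℤ) :
    ∀ n : ℕ, Integrable (fun σ : ChainConfig => (σ x).1 ^ n) ν :=
  (moments_of_integrable_abs_pow_add (measurable_pi_apply x).fst.aestronglyMeasurable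
    (measurable_pi_apply x).snd.aestronglyMeasurable (fun m => hmom m x)).1

/-- All power moments of the momenta, from the site-moment hypothesis of the route. [folklore] -/
theorem moments_momentum (hmom : ∀ (m : ℕ) (x : ℤ),
      Integrable (fun σ : ChainConfig => |(σ x).1| ^ m + |(σ x).2| ^ m) ν) (x : ℤ) :
    ∀ n : ℕ, Integrable (fun σ : ChainConfig => (σ x).2 ^ n) ν :=
  (moments_of_integrable_abs_pow_add (measurable_pi_apply x).fst.aestronglyMeasurable
    (measurable_pi_apply x).snd.aestronglyMeasurable (fun m => hmom m x)).2

/-- All power moments of `V'(q_{x+1} - q_x) = r_x + β r_x³`. [folklore] -/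
theorem moments_deriv_V (hmom : ∀ (m : ℕ) (x : ℤ),
      Integrable (fun σ : ChainConfig => |(σ x).1| ^ m + |(σ x).2| ^ m) ν) (x : ℤ) :
    ∀ n : ℕ, Integrable (fun σ : ChainConfig => deriv (pinnedChain ω₂ lam β γ).V ((σ (x + 1)).1 - (σ x).1) ^ n) ν := by
  have hr := moments_sub (moments_position hmom (x + 1)) (moments_position hmom x)
  have h := moments_add hr (moments_const_mul (moments_pow hr 3) β)
  intro n
  refine (h n).congr (Eventually.of_forall fun σ => ?_)
  simp only [CesaroUpgrade.pinnedChain_deriv_V]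

/-- All power moments of the force `F_x` of the pinned chain. [folklore] -/
theorem moments_force (hmom : ∀ (m : ℕ) (x : ℤ),
      Integrable (fun σ : ChainConfig => |(σ x).1| ^ m + |(σ x).2| ^ m) ν) (x : ℤ) :
    ∀ n : ℕ, Integrable (fun σ : ChainConfig => (pinnedChain ω₂ lam β γ).force σ x ^ n) ν := by
  have hq := moments_position hmom x
  have hU := moments_neg (moments_add (moments_const_mul hq ω₂) (moments_const_mul (moments_pow hq 3) lam))
  have hV1 := moments_deriv_V ω₂ lam β γ hmom x
  have hV0 := moments_deriv_V ω₂ lam β γ hmom (x - 1)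
  have h := moments_sub (moments_add hU hV1) hV0
  intro n
  refine (h n).congr (Eventually.of_forall fun σ => ?_)
  simp only [OscillatorChain.force_eq, CesaroUpgrade.pinnedChain_deriv_U, sub_add_cancel]

/-! ### Observable 1: the on-site energy `p_x²/2 + U(q_x)` -/

/-- Derivative of the on-site energy profile `y ↦ p²/2 + U(q)` (one-site box). [folklore] -/
theorem hasFDerivAt_siteProfile (y : Fin (0 + 1) → ℝ × ℝ) :
    HasFDerivAt (fun y : Fin (0 + 1) → ℝ × ℝ => (y 0).2 ^ 2 / 2 + (pinnedChain ω₂ lam β γ).U (y 0).1)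
      ((y 0).2 • ((ContinuousLinearMap.snd ℝ ℝ ℝ).comp
        (ContinuousLinearMap.proj (R := ℝ) (φ := fun _ : Fin (0 + 1) => ℝ × ℝ) 0)) +
        (ω₂ * (y 0).1 + lam * (y 0).1 ^ 3) • ((ContinuousLinearMap.fst ℝ ℝ ℝ).comp
          (ContinuousLinearMap.proj (R := ℝ) (φ := fun _ : Fin (0 + 1) => ℝ × ℝ) 0))) y := by
  have h0 : HasFDerivAt (fun y : Fin (0 + 1) → ℝ × ℝ => y 0)
      (ContinuousLinearMap.proj (R := ℝ) (φ := fun _ : Fin (0 + 1) => ℝ × ℝ) 0) y :=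
    hasFDerivAt_apply 0 y
  have hkin : HasDerivAt (fun t : ℝ => t ^ 2 / 2) ((y 0).2) ((y 0).2) := by
    have h := ((hasDerivAt_id ((y 0).2)).pow 2).div_const 2
    have heq : (2 : ℕ) * id (y 0).2 ^ (2 - 1) * 1 / 2 = (y 0).2 := by simp
    rw [heq] at h
    exact h
  have hU : HasDerivAt (pinnedChain ω₂ lam β γ).U (ω₂ * (y 0).1 + lam * (y 0).1 ^ 3) (y 0).1 := by
    rw [← CesaroUpgrade.pinnedChain_deriv_U ω₂ lam β γ]
    refine DifferentiableAt.hasDerivAt ?_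
    show DifferentiableAt ℝ (fun q : ℝ => ω₂ * q ^ 2 / 2 + lam * q ^ 4 / 4) (y 0).1
    fun_prop
  exact (hkin.comp_hasFDerivAt y h0.snd).add (hU.comp_hasFDerivAt y h0.fst)

/-- The on-site energy profile is `C¹`. [folklore] -/
theorem contDiff_siteProfile :
    ContDiff ℝ 1 (fun y : Fin (0 + 1) → ℝ × ℝ => (y 0).2 ^ 2 / 2 + (pinnedChain ω₂ lam β γ).U (y 0).1) := by
  show ContDiff ℝ 1 (fun y : Fin (0 + 1) → ℝ × ℝ =>
    (y 0).2 ^ 2 / 2 + (ω₂ * (y 0).1 ^ 2 / 2 + lam * (y 0).1 ^ 4 / 4))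
  fun_prop

/-- **`𝒜(p_x²/2 + U(q_x)) = p_x (V'(q_{x+1} - q_x) - V'(q_x - q_{x-1}))`** (the pinning force
cancels). [folklore] -/
theorem liouvilleZ_siteEnergy (σ : ChainConfig) (x : ℤ) :
    liouvilleZ (pinnedChain ω₂ lam β γ) ((fun y : Fin (0 + 1) → ℝ × ℝ => (y 0).2 ^ 2 / 2 + (pinnedChain ω₂ lam β γ).U (y 0).1) ∘
      boxRestrictAt x 0) σ =
      (σ x).2 * (deriv (pinnedChain ω₂ lam β γ).V ((σ (x + 1)).1 - (σ x).1) - deriv (pinnedChain ω₂ lam β γ).V ((σ x).1 - (σ (x - 1)).1)) := by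
  have hd := hasFDerivAt_siteProfile ω₂ lam β γ (boxRestrictAt x 0 σ)
  rw [liouvilleZ_comp_boxRestrictAt _ x 0 σ hd.differentiableAt, hd.fderiv]
  simp [OscillatorChain.force_eq, CesaroUpgrade.pinnedChain_deriv_U]
  ring

/-! ### Observable 2: the bond energy `V(q_{x+1} - q_x)` -/

/-- Derivative of the bond energy profile `y ↦ V(q₁ - q₀)` (two-site box). [folklore] -/
theorem hasFDerivAt_bondProfile (y : Fin (1 + 1) → ℝ × ℝ) :
    HasFDerivAt (fun y : Fin (1 + 1) → ℝ × ℝ => (pinnedChain ω₂ lam β γ).V ((y 1).1 - (y 0).1))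
      ((((y 1).1 - (y 0).1) + β * ((y 1).1 - (y 0).1) ^ 3) •
        (((ContinuousLinearMap.fst ℝ ℝ ℝ).comp
            (ContinuousLinearMap.proj (R := ℝ) (φ := fun _ : Fin (1 + 1) => ℝ × ℝ) 1)) -
          ((ContinuousLinearMap.fst ℝ ℝ ℝ).comp
            (ContinuousLinearMap.proj (R := ℝ) (φ := fun _ : Fin (1 + 1) => ℝ × ℝ) 0)))) y := by
  have h0 : HasFDerivAt (fun y : Fin (1 + 1) → ℝ × ℝ => y 0)
      (ContinuousLinearMap.proj (R := ℝ) (φ := fun _ : Fin (1 + 1) => ℝ × ℝ) 0) y :=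
    hasFDerivAt_apply 0 y
  have h1 : HasFDerivAt (fun y : Fin (1 + 1) → ℝ × ℝ => y 1)
      (ContinuousLinearMap.proj (R := ℝ) (φ := fun _ : Fin (1 + 1) => ℝ × ℝ) 1) y :=
    hasFDerivAt_apply 1 y
  have hV : HasDerivAt (pinnedChain ω₂ lam β γ).V
      (((y 1).1 - (y 0).1) + β * ((y 1).1 - (y 0).1) ^ 3) ((y 1).1 - (y 0).1) := by
    rw [← CesaroUpgrade.pinnedChain_deriv_V ω₂ lam β γ]
    refine DifferentiableAt.hasDerivAt ?_
    show DifferentiableAt ℝ (fun r : ℝ => r ^ 2 / 2 + β * r ^ 4 / 4) ((y 1).1 - (y 0).1)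
    fun_prop
  exact hV.comp_hasFDerivAt y (h1.fst.sub h0.fst)

/-- The bond energy profile is `C¹`. [folklore] -/
theorem contDiff_bondProfile :
    ContDiff ℝ 1 (fun y : Fin (1 + 1) → ℝ × ℝ => (pinnedChain ω₂ lam β γ).V ((y 1).1 - (y 0).1)) := by
  show ContDiff ℝ 1 (fun y : Fin (1 + 1) → ℝ × ℝ =>
    ((y 1).1 - (y 0).1) ^ 2 / 2 + β * ((y 1).1 - (y 0).1) ^ 4 / 4)
  fun_prop

/-- **`𝒜 V(q_{x+1} - q_x) = V'(q_{x+1} - q_x) (p_{x+1} - p_x)`**. [folklore] -/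
theorem liouvilleZ_bondEnergy (σ : ChainConfig) (x : ℤ) :
    liouvilleZ (pinnedChain ω₂ lam β γ) ((fun y : Fin (1 + 1) → ℝ × ℝ => (pinnedChain ω₂ lam β γ).V ((y 1).1 - (y 0).1)) ∘ boxRestrictAt x 1) σ =
      deriv (pinnedChain ω₂ lam β γ).V ((σ (x + 1)).1 - (σ x).1) * ((σ (x + 1)).2 - (σ x).2) := by
  have hd := hasFDerivAt_bondProfile ω₂ lam β γ (boxRestrictAt x 1 σ)
  rw [liouvilleZ_comp_boxRestrictAt _ x 1 σ hd.differentiableAt, hd.fderiv]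
  simp [Fin.sum_univ_succ, CesaroUpgrade.pinnedChain_deriv_V]
  ring

/-! ### The two stationarity identities -/

/-- All power moments of `V'(q_x - q_{x-1})` (left bond). [folklore] -/
theorem moments_deriv_V_left (hmom : ∀ (m : ℕ) (x : ℤ),
      Integrable (fun σ : ChainConfig => |(σ x).1| ^ m + |(σ x).2| ^ m) ν) (x : ℤ) :
    ∀ n : ℕ, Integrable (fun σ : ChainConfig => deriv (pinnedChain ω₂ lam β γ).V ((σ x).1 - (σ (x - 1)).1) ^ n) ν := by
  intro n
  refine (moments_deriv_V ω₂ lam β γ hmom (x - 1) n).congr (Eventually.of_forall fun σ => ?_)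
  simp only [sub_add_cancel]

/-- All power moments of the on-site energy `p_x²/2 + U(q_x)`. [folklore] -/
theorem moments_siteEnergy (hmom : ∀ (m : ℕ) (x : ℤ),
      Integrable (fun σ : ChainConfig => |(σ x).1| ^ m + |(σ x).2| ^ m) ν) (x : ℤ) :
    ∀ n : ℕ, Integrable (fun σ : ChainConfig => ((σ x).2 ^ 2 / 2 + (pinnedChain ω₂ lam β γ).U (σ x).1) ^ n) ν := by
  have hq := moments_position hmom x
  have hp := moments_momentum hmom x
  have h := moments_add (moments_const_mul (moments_pow hp 2) (1 / 2))
    (moments_add (moments_const_mul (moments_pow hq 2) (ω₂ / 2))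
      (moments_const_mul (moments_pow hq 4) (lam / 4)))
  intro n
  refine (h n).congr (Eventually.of_forall fun σ => ?_)
  show (1 / 2 * (σ x).2 ^ 2 + (ω₂ / 2 * (σ x).1 ^ 2 + lam / 4 * (σ x).1 ^ 4)) ^ n =
    ((σ x).2 ^ 2 / 2 + (ω₂ * (σ x).1 ^ 2 / 2 + lam * (σ x).1 ^ 4 / 4)) ^ n
  ring

/-- All power moments of the bond energy `V(q_{x+1} - q_x)`. [folklore] -/
theorem moments_bondEnergy (hmom : ∀ (m : ℕ) (x : ℤ),
      Integrable (fun σ : ChainConfig => |(σ x).1| ^ m + |(σ x).2| ^ m) ν) (x : ℤ) :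
    ∀ n : ℕ, Integrable (fun σ : ChainConfig => (pinnedChain ω₂ lam β γ).V ((σ (x + 1)).1 - (σ x).1) ^ n) ν := by
  have hr := moments_sub (moments_position hmom (x + 1)) (moments_position hmom x)
  have h := moments_add (moments_const_mul (moments_pow hr 2) (1 / 2))
    (moments_const_mul (moments_pow hr 4) (β / 4))
  intro n
  refine (h n).congr (Eventually.of_forall fun σ => ?_)
  show (1 / 2 * ((σ (x + 1)).1 - (σ x).1) ^ 2 + β / 4 * ((σ (x + 1)).1 - (σ x).1) ^ 4) ^ n =
    (((σ (x + 1)).1 - (σ x).1) ^ 2 / 2 + β * ((σ (x + 1)).1 - (σ x).1) ^ 4 / 4) ^ n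
  ring

/-- **Stationarity identity of the on-site energy**: for a time-invariant state with all site
moments, `∫ p_x (V'(q_{x+1} - q_x) - V'(q_x - q_{x-1})) dν = 0`. [folklore] -/
theorem integral_momentum_mul_deriv_V_sub_eq_zero (hν : IsTimeInvariant (pinnedChain ω₂ lam β γ) ν)
    (hmom : ∀ (m : ℕ) (x : ℤ), Integrable (fun σ : ChainConfig => |(σ x).1| ^ m + |(σ x).2| ^ m) ν)
    (x : ℤ) :
    ∫ σ, (σ x).2 * (deriv (pinnedChain ω₂ lam β γ).V ((σ (x + 1)).1 - (σ x).1) -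
      deriv (pinnedChain ω₂ lam β γ).V ((σ x).1 - (σ (x - 1)).1)) ∂ν = 0 := by
  have hfun : (fun σ : ChainConfig => (σ x).2 * (deriv (pinnedChain ω₂ lam β γ).V ((σ (x + 1)).1 - (σ x).1) -
      deriv (pinnedChain ω₂ lam β γ).V ((σ x).1 - (σ (x - 1)).1))) =
      liouvilleZ (pinnedChain ω₂ lam β γ) ((fun y : Fin (0 + 1) → ℝ × ℝ => (y 0).2 ^ 2 / 2 + (pinnedChain ω₂ lam β γ).U (y 0).1) ∘
        boxRestrictAt x 0) :=
    funext fun σ => (liouvilleZ_siteEnergy ω₂ lam β γ σ x).symm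
  have hint : Integrable (fun σ : ChainConfig => (σ x).2 * (deriv (pinnedChain ω₂ lam β γ).V ((σ (x + 1)).1 - (σ x).1) -
      deriv (pinnedChain ω₂ lam β γ).V ((σ x).1 - (σ (x - 1)).1))) ν :=
    integrable_of_moments (moments_mul (moments_momentum hmom x)
      (moments_sub (moments_deriv_V ω₂ lam β γ hmom x) (moments_deriv_V_left ω₂ lam β γ hmom x)))
  rw [hfun] at hint ⊢
  refine integral_liouvilleZ_comp_boxRestrictAt_eq_zero (pinnedChain ω₂ lam β γ) hν x 0 (contDiff_siteProfile ω₂ lam β γ)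
    hint ?_
  have henv : Integrable (fun σ : ChainConfig => |(σ x).2 ^ 2 / 2 + (pinnedChain ω₂ lam β γ).U (σ x).1| *
      (|(σ x).2| + |(pinnedChain ω₂ lam β γ).force σ x|)) ν :=
    integrable_of_moments (moments_mul (moments_abs (moments_siteEnergy ω₂ lam β γ hmom x))
      (moments_add (moments_abs (moments_momentum hmom x))
        (moments_abs (moments_force ω₂ lam β γ hmom x))))
  refine henv.congr (Eventually.of_forall fun σ => ?_)
  simp

/-- **Stationarity identity of the bond energy**: for a time-invariant state with all site
moments, `∫ V'(q_{x+1} - q_x) (p_{x+1} - p_x) dν = 0`. [folklore] -/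
theorem integral_deriv_V_mul_momentum_sub_eq_zero (hν : IsTimeInvariant (pinnedChain ω₂ lam β γ) ν)
    (hmom : ∀ (m : ℕ) (x : ℤ), Integrable (fun σ : ChainConfig => |(σ x).1| ^ m + |(σ x).2| ^ m) ν)
    (x : ℤ) :
    ∫ σ, deriv (pinnedChain ω₂ lam β γ).V ((σ (x + 1)).1 - (σ x).1) * ((σ (x + 1)).2 - (σ x).2) ∂ν = 0 := by
  have hfun : (fun σ : ChainConfig => deriv (pinnedChain ω₂ lam β γ).V ((σ (x + 1)).1 - (σ x).1) * ((σ (x + 1)).2 - (σ x).2)) =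
      liouvilleZ (pinnedChain ω₂ lam β γ) ((fun y : Fin (1 + 1) → ℝ × ℝ => (pinnedChain ω₂ lam β γ).V ((y 1).1 - (y 0).1)) ∘ boxRestrictAt x 1) :=
    funext fun σ => (liouvilleZ_bondEnergy ω₂ lam β γ σ x).symm
  have hint : Integrable (fun σ : ChainConfig => deriv (pinnedChain ω₂ lam β γ).V ((σ (x + 1)).1 - (σ x).1) *
      ((σ (x + 1)).2 - (σ x).2)) ν :=
    integrable_of_moments (moments_mul (moments_deriv_V ω₂ lam β γ hmom x)
      (moments_sub (moments_momentum hmom (x + 1)) (moments_momentum hmom x)))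
  rw [hfun] at hint ⊢
  refine integral_liouvilleZ_comp_boxRestrictAt_eq_zero (pinnedChain ω₂ lam β γ) hν x 1 (contDiff_bondProfile ω₂ lam β γ)
    hint ?_
  have henv : Integrable (fun σ : ChainConfig => |(pinnedChain ω₂ lam β γ).V ((σ (x + 1)).1 - (σ x).1)| *
      ((|(σ x).2| + |(pinnedChain ω₂ lam β γ).force σ x|) + (|(σ (x + 1)).2| + |(pinnedChain ω₂ lam β γ).force σ (x + 1)|))) ν :=
    integrable_of_moments (moments_mul (moments_abs (moments_bondEnergy ω₂ lam β γ hmom x))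
      (moments_add
        (moments_add (moments_abs (moments_momentum hmom x))
          (moments_abs (moments_force ω₂ lam β γ hmom x)))
        (moments_add (moments_abs (moments_momentum hmom (x + 1)))
          (moments_abs (moments_force ω₂ lam β γ hmom (x + 1))))))
  refine henv.congr (Eventually.of_forall fun σ => ?_)
  simp [Fin.sum_univ_succ]

end PinnedChain

end Summit.AtomisticToContinuum.FouriersLaw.Theorems.ParityLiouvilleSeed

end
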